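import Summits.QuantumFields.YangMills.Theorems.BalabanUVNodesN19SingleModeLowerBound

/-!
# YM-DAG node N19 (= NE7 proper) — THE LOWER SIDE OF THE KINK, PART 5: the LAW-LEVEL (equal-moments ∕ `W₁`) face — an explicit pair of
# probability laws with equal moments of order `≤ t` that integrate `|x|`, the odd-power sums and `sin(ωΣ_{i≤d}|x_i|)` differently by `≍ a∕t`

Cell `pub-ymgap`, HUMAN RULING D-0062 (Track A) ∕ D-0149 (work-bound push), R141 (C) wider-strategy seat `pub-ymgap-dag-n19-e` (strategy
s3 = ALTERNATIVE CURRENCY), generation g31, module 5 (lineage module 136).  Route `Summits/QuantumFields/YangMills/Theses/BalabanUVNodes.lean`,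
cluster item K3⁸ «SpineGivenEndpointR13SepCoPHV» (stmt-QuantumFields-27366); filed `--supports` that item `--as helper` (it proves no registered
stub).  COUNT-NEUTRAL: [folklore] measure-theoretic bookkeeping over Mathlib (`Measure.withDensity`, `Measure.map`, `integral_map`) and PARTS 1–3
BY NAME; TOY laws; no scheme object, no Theses import; NOT a discharge claim.

CONTENT (mirror of module 125's `abs_integral_*_sub_le_of_moments`, which are UPPER bounds for laws agreeing on `Π_t`).  With PART 1's kernel
`D = D_{t+1,t}` and `Z = ∫_{−π}^{π} D⁺`, the laws `P = sin_*(D⁺∕Z·du)`, `Q = sin_*(D⁻∕Z·du)` on `[−1,1]` (`u ∈ (−π, π]`) satisfy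
`∫g dP − ∫g dQ = (1∕Z)∫_{−π}^{π} g(sin u)D(u) du = (2∕Z)·Λ(g)` — so they AGREE on every polynomial of degree `≤ t` and DISAGREE on the kinks
by `2|Λ|∕Z ≥ 2|Λ|∕(π(t+1))`:
§1 `functional_oddPowerSum_le` (PART 2's value bound as a standalone lemma: `Λ(f) ≤ −a(t+2)∕(9t+6)`);
§2 the kernel on `[−π, π]`: `integral_comp_sin_symm` (`∫_{−π}^{π} g(sin u)E(u) du = ∫_0^π (g(sin u)+g(−sin u))E(u) du` for even `E`) ·
`doubleCosSum_even` · `integral_doubleCosSum_eq_zero` · `integral_abs_doubleCosSum_le` (`∫_{−π}^{π}|D| ≤ 2π(t+1)`) · `integral_posPart_eq`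
(`∫D⁺ = ∫D⁻ = ½∫|D|`) · `integral_posPart_pos` (`Z > 0`, since `Λ(|x|) ≠ 0`);
§3 the density laws `sin_*(ρ du)`: `integral_sinLaw` · `sinLaw_univ` · `sinLaw_Icc_compl`;
§4 ★★★ `exists_laws_equalMoments_oddPowerSum` — for every `t ≥ 1` TWO probability laws `P, Q` on `[−1,1]` with `∫x^j dP = ∫x^j dQ` (`j ≤ t`) such
that for EVERY `a ≥ 0` and `2n₀+1 ≤ t`: `∫f dQ − ∫f dP ≥ 2a∕(π(9t+6))` (`f` the odd-power sum), in particular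
★★★ `∫|x| dQ − ∫|x| dP ≥ 2∕(π(9t+6))` (the same pair for all kinks); ★★ `exists_laws_equalMoments_sin` (`t ≥ 6`, `0 ≤ a ≤ t∕10`:
`|∫sin(a|x|)dP − ∫sin(a|x|)dQ| ≥ a∕(10πt)`); §5 ★★★ `exists_laws_equalMixedMoments_sin_l1Norm` — on the cube `[−1,1]^ι` (diagonal push-forward):
probability laws with equal MIXED moments of total degree `≤ t` and `|∫sin(ωΣ_i|x_i|)dP − ∫sin(ωΣ_i|x_i|)dQ| ≥ ω|ι|∕(10πt)` for `ω|ι| ≤ t∕10`,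
`t ≥ 6` — against module 125's `≤ 600log₂t(log₂t + 4ω|ι|)∕t`: the `W₁`-form of the single-mode row is TWO-SIDED up to `log²t`.

HONEST FRAMING (binding).  Elementary and [folklore]; TOY laws; NO consumer in the DAG today (an optimality map of the seat's own currency);
nothing of Bałaban's instantiated; NE7 NOT PRINTED, NOT proved; N19 NOT discharged; count-neutral.  One finite `T⁴` programme at fixed `ε`;
nothing continuum ∕ `ℝ⁴` ∕ OS ∕ mass-gap ∕ Clay.  Constants not optimised.  0 `def` ∕ 0 `sorry`.
-/

noncomputable section

open Finset Real MeasureTheory intervalIntegral Polynomial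

namespace Summit.QuantumFields.YangMills.Theorems.BalabanUVNodesN19KinkLowerBoundLaws

open Summit.QuantumFields.YangMills.Theorems.BalabanUVNodesN19ShiftedFejerKernel
open Summit.QuantumFields.YangMills.Theorems.BalabanUVNodesN19KinkLowerBound
open Summit.QuantumFields.YangMills.Theorems.BalabanUVNodesN19SingleModeLowerBound (abs_sin_sub_oddPowerSum_le)

/-! ## §1 The value of the functional on the odd-power sums [folklore] -/

/-- **THE VALUE BOUND** (PART 2's computation as a standalone lemma).  With `D = D_{t+1,t}`, `2n₀+1 ≤ t`, `a ≥ 0`: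
`∫_0^π ½(f(sin u) + f(−sin u))·D(u) du ≤ −a(t+2)∕(9t+6)` for `f(x) = Σ_{k≤n₀}(−1)^k a^{2k+1}|x|^{2k+1}∕(2k+1)!`. [folklore] -/
theorem functional_oddPowerSum_le {t n₀ : ℕ} (ht : 1 ≤ t) (hn₀ : 2 * n₀ + 1 ≤ t) {a : ℝ} (ha : 0 ≤ a) :
    ∫ u in (0 : ℝ)..π,
        ((∑ k ∈ range (n₀ + 1), (-1) ^ k * a ^ (2 * k + 1) / ((2 * k + 1).factorial : ℝ) *
            |Real.sin u| ^ (2 * k + 1)) +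
          (∑ k ∈ range (n₀ + 1), (-1) ^ k * a ^ (2 * k + 1) / ((2 * k + 1).factorial : ℝ) *
            |-Real.sin u| ^ (2 * k + 1))) / 2 *
        ∑ j ∈ range (t + 1), ∑ j' ∈ range (t + 1), Real.cos ((((t + 1) + t + j - j' : ℕ) : ℝ) * u) ≤
      -(a * (t + 2) / (9 * t + 6)) := by
  rw [functional_oddPowerSum_eq (T := t + 1) t (by omega : 2 * n₀ + 2 ≤ t + 1) a, neg_le_neg_iff]
  have ht0 : (0 : ℝ) < t := by exact_mod_cast ht
  have hden : (0 : ℝ) < (3 * t + 1) ^ 2 - 1 := by nlinarith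
  have hjj : ∀ j ∈ range (t + 1), ∀ j' ∈ range (t + 1),
      a * (1 + Real.cos (π * (((t + 1) + t + j - j' : ℕ) : ℝ))) / ((3 * t + 1) ^ 2 - 1) ≤
        ∑ k ∈ range (n₀ + 1), a ^ (2 * k + 1) * (1 + Real.cos (π * (((t + 1) + t + j - j' : ℕ) : ℝ))) /
          ∏ i ∈ range (k + 1), (((((t + 1) + t + j - j' : ℕ) : ℝ)) ^ 2 - (2 * i + 1) ^ 2) := by
    intro j hj j' hj'
    have hjm := Finset.mem_range.1 hj
    have hjm' := Finset.mem_range.1 hj'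
    have hcos : 0 ≤ 1 + Real.cos (π * (((t + 1) + t + j - j' : ℕ) : ℝ)) := by
      linarith [Real.neg_one_le_cos (π * (((t + 1) + t + j - j' : ℕ) : ℝ))]
    have hL1 : (2 : ℝ) ≤ (((t + 1) + t + j - j' : ℕ) : ℝ) := by
      exact_mod_cast (show 2 ≤ (t + 1) + t + j - j' by omega)
    have hL2 : (((t + 1) + t + j - j' : ℕ) : ℝ) ≤ 3 * t + 1 := by
      exact_mod_cast (show (t + 1) + t + j - j' ≤ 3 * t + 1 by omega)
    calc a * (1 + Real.cos (π * (((t + 1) + t + j - j' : ℕ) : ℝ))) / ((3 * t + 1) ^ 2 - 1)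
        ≤ a * (1 + Real.cos (π * (((t + 1) + t + j - j' : ℕ) : ℝ))) /
            ((((t + 1) + t + j - j' : ℕ) : ℝ) ^ 2 - 1) :=
          div_le_div_of_nonneg_left (mul_nonneg ha hcos) (by nlinarith) (by nlinarith)
      _ = a ^ (2 * 0 + 1) * (1 + Real.cos (π * (((t + 1) + t + j - j' : ℕ) : ℝ))) /
            ∏ i ∈ range (0 + 1), (((((t + 1) + t + j - j' : ℕ) : ℝ)) ^ 2 - (2 * i + 1) ^ 2) := by simp
      _ ≤ _ := by
          refine Finset.single_le_sum (f := fun k => a ^ (2 * k + 1) *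
            (1 + Real.cos (π * (((t + 1) + t + j - j' : ℕ) : ℝ))) /
            ∏ i ∈ range (k + 1), (((((t + 1) + t + j - j' : ℕ) : ℝ)) ^ 2 - (2 * i + 1) ^ 2))
            (fun k hk => ?_) (Finset.mem_range.2 (Nat.succ_pos n₀))
          have hk' : k ≤ n₀ := Nat.lt_succ_iff.1 (Finset.mem_range.1 hk)
          exact div_nonneg (mul_nonneg (pow_nonneg ha _) hcos)
            (prod_sq_sub_odd_sq_pos k (L := (t + 1) + t + j - j') (by omega)).le
  have hcount : ∑ j ∈ range (t + 1), ∑ j' ∈ range (t + 1), (1 + Real.cos (π * (((t + 1) + t + j - j' : ℕ) : ℝ))) =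
      ((t : ℝ) + 1) ^ 2 + ∑ j ∈ range (t + 1), ∑ j' ∈ range (t + 1),
        Real.cos ((((t + 1) + t + j - j' : ℕ) : ℝ) * π) := by
    simp only [Finset.sum_add_distrib, Finset.sum_const, Finset.card_range, nsmul_eq_mul, mul_comm π]
    push_cast
    ring
  have hinner : ((t : ℝ) + 1) ^ 2 - 1 ≤ ∑ j ∈ range (t + 1), ∑ j' ∈ range (t + 1),
      (1 + Real.cos (π * (((t + 1) + t + j - j' : ℕ) : ℝ))) := by
    rw [hcount]
    linarith [neg_one_le_doubleCosSum_pi (t + 1) t]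
  have h1 : a * (t + 2) / (9 * t + 6) = a * (((t : ℝ) + 1) ^ 2 - 1) / ((3 * t + 1) ^ 2 - 1) := by
    rw [div_eq_div_iff (by nlinarith) hden.ne']
    ring
  calc a * (t + 2) / (9 * t + 6) = a * (((t : ℝ) + 1) ^ 2 - 1) / ((3 * t + 1) ^ 2 - 1) := h1
    _ ≤ a * (∑ j ∈ range (t + 1), ∑ j' ∈ range (t + 1),
          (1 + Real.cos (π * (((t + 1) + t + j - j' : ℕ) : ℝ)))) / ((3 * t + 1) ^ 2 - 1) :=
        div_le_div_of_nonneg_right (mul_le_mul_of_nonneg_left hinner ha) hden.le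
    _ = ∑ j ∈ range (t + 1), ∑ j' ∈ range (t + 1),
          a * (1 + Real.cos (π * (((t + 1) + t + j - j' : ℕ) : ℝ))) / ((3 * t + 1) ^ 2 - 1) := by
        rw [Finset.mul_sum, Finset.sum_div]
        refine Finset.sum_congr rfl fun j _ => ?_
        rw [Finset.mul_sum, Finset.sum_div]
    _ ≤ _ := Finset.sum_le_sum fun j hj => Finset.sum_le_sum fun j' hj' => hjj j hj j' hj'

/-! ## §2 The kernel on `[−π, π]` [folklore] -/

/-- Symmetrisation: for an even weight `E`, `∫_{−π}^{π} g(sin u)E(u) du = ∫_0^π (g(sin u) + g(−sin u))E(u) du` (continuous data). [bookkeeping] -/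
theorem integral_comp_sin_symm {g E : ℝ → ℝ} (hg : Continuous g) (hE : Continuous E) (heven : ∀ u, E (-u) = E u) :
    ∫ u in (-π)..π, g (Real.sin u) * E u = ∫ u in (0 : ℝ)..π, (g (Real.sin u) + g (-Real.sin u)) * E u := by
  have hc : Continuous fun u => g (Real.sin u) * E u := (hg.comp Real.continuous_sin).mul hE
  rw [← intervalIntegral.integral_add_adjacent_intervals (b := 0) (hc.intervalIntegrable _ _) (hc.intervalIntegrable _ _)]
  have hneg : ∫ u in (-π)..(0 : ℝ), g (Real.sin u) * E u = ∫ u in (0 : ℝ)..π, g (-Real.sin u) * E u := by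
    have h := intervalIntegral.integral_comp_neg (a := (0 : ℝ)) (b := π) (fun u => g (Real.sin u) * E u)
    simp only [Real.sin_neg, heven, neg_zero] at h
    exact h.symm
  rw [hneg, ← intervalIntegral.integral_add ((by fun_prop : Continuous fun u => g (-Real.sin u) * E u).intervalIntegrable
    _ _) (hc.intervalIntegrable _ _)]
  exact intervalIntegral.integral_congr fun u _ => by ring

/-- The kernel is even. [bookkeeping] -/
theorem doubleCosSum_even (T m : ℕ) (u : ℝ) :
    ∑ j ∈ range (m + 1), ∑ j' ∈ range (m + 1), Real.cos (((T + m + j - j' : ℕ) : ℝ) * -u) =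
      ∑ j ∈ range (m + 1), ∑ j' ∈ range (m + 1), Real.cos (((T + m + j - j' : ℕ) : ℝ) * u) := by
  simp only [mul_neg, Real.cos_neg]

/-- The kernel has zero mean on `[−π, π]` (all its frequencies are `≥ T ≥ 1`). [folklore] -/
theorem integral_doubleCosSum_eq_zero {T : ℕ} (hT : 1 ≤ T) (m : ℕ) :
    ∫ u in (-π)..π, ∑ j ∈ range (m + 1), ∑ j' ∈ range (m + 1), Real.cos (((T + m + j - j' : ℕ) : ℝ) * u) = 0 := by
  have hD : Continuous fun u : ℝ => ∑ j ∈ range (m + 1), ∑ j' ∈ range (m + 1),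
      Real.cos (((T + m + j - j' : ℕ) : ℝ) * u) := by fun_prop
  have h := integral_comp_sin_symm (g := fun _ => (1 : ℝ)) continuous_const hD (doubleCosSum_even T m)
  simp only [one_mul] at h
  rw [h]
  have h2 : ∫ u in (0 : ℝ)..π, (1 + 1) * ∑ j ∈ range (m + 1), ∑ j' ∈ range (m + 1),
      Real.cos (((T + m + j - j' : ℕ) : ℝ) * u) =
      2 * ∑ j ∈ range (m + 1), ∑ j' ∈ range (m + 1), ∫ u in (0 : ℝ)..π, Real.cos (((T + m + j - j' : ℕ) : ℝ) * u) := by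
    rw [show (1 : ℝ) + 1 = 2 by norm_num, intervalIntegral.integral_const_mul,
      intervalIntegral.integral_finsetSum fun j _ => (by fun_prop : Continuous fun u : ℝ =>
        ∑ j' ∈ range (m + 1), Real.cos (((T + m + j - j' : ℕ) : ℝ) * u)).intervalIntegrable _ _]
    congr 1
    refine Finset.sum_congr rfl fun j _ => ?_
    rw [intervalIntegral.integral_finsetSum fun j' _ => (by fun_prop : Continuous fun u : ℝ =>
        Real.cos (((T + m + j - j' : ℕ) : ℝ) * u)).intervalIntegrable _ _]
  rw [h2]
  refine mul_eq_zero_of_right _ (Finset.sum_eq_zero fun j _ => Finset.sum_eq_zero fun j' hj' => ?_)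
  have h0 := integral_cos_nat_mul_eq_zero (L := T + m + j - j') (by have := Finset.mem_range.1 hj'; omega)
  simpa only [pow_zero, one_mul] using h0

/-- `∫_{−π}^{π}|D_{T,m}| ≤ 2π(m+1)` (the Fejér factor dominates `|D|`). [folklore] -/
theorem integral_abs_doubleCosSum_le (T m : ℕ) :
    ∫ u in (-π)..π, |∑ j ∈ range (m + 1), ∑ j' ∈ range (m + 1), Real.cos (((T + m + j - j' : ℕ) : ℝ) * u)| ≤
      2 * (π * (m + 1)) := by
  have hD : Continuous fun u : ℝ => |∑ j ∈ range (m + 1), ∑ j' ∈ range (m + 1),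
      Real.cos (((T + m + j - j' : ℕ) : ℝ) * u)| := by fun_prop
  have h := integral_comp_sin_symm (g := fun _ => (1 : ℝ)) continuous_const hD
    (fun u => by rw [doubleCosSum_even])
  simp only [one_mul] at h
  rw [h, ← integral_fejerFactor m, show (1 : ℝ) + 1 = 2 by norm_num, intervalIntegral.integral_const_mul, two_mul]
  have hle := intervalIntegral.integral_mono_on (μ := volume) Real.pi_pos.le (hD.intervalIntegrable _ _)
    ((by fun_prop : Continuous fun s : ℝ => (∑ j ∈ range (m + 1), Real.cos (j * s)) ^ 2 +
      (∑ j ∈ range (m + 1), Real.sin (j * s)) ^ 2).intervalIntegrable _ _) fun u _ => abs_doubleCosSum_le T m u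
  linarith

/-- The positive and negative parts of the kernel have the same mass `½∫|D|`. [bookkeeping] -/
theorem integral_posPart_eq {T : ℕ} (hT : 1 ≤ T) (m : ℕ) :
    (∫ u in (-π)..π, max (∑ j ∈ range (m + 1), ∑ j' ∈ range (m + 1), Real.cos (((T + m + j - j' : ℕ) : ℝ) * u)) 0 =
      ∫ u in (-π)..π, max (-∑ j ∈ range (m + 1), ∑ j' ∈ range (m + 1), Real.cos (((T + m + j - j' : ℕ) : ℝ) * u)) 0) ∧
    (∫ u in (-π)..π, max (∑ j ∈ range (m + 1), ∑ j' ∈ range (m + 1), Real.cos (((T + m + j - j' : ℕ) : ℝ) * u)) 0 =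
      (1 / 2) * ∫ u in (-π)..π, |∑ j ∈ range (m + 1), ∑ j' ∈ range (m + 1),
        Real.cos (((T + m + j - j' : ℕ) : ℝ) * u)|) := by
  set D : ℝ → ℝ := fun u => ∑ j ∈ range (m + 1), ∑ j' ∈ range (m + 1),
    Real.cos (((T + m + j - j' : ℕ) : ℝ) * u) with hDdef
  have hD : Continuous D := by rw [hDdef]; fun_prop
  have hp : Continuous fun u => max (D u) 0 := hD.max continuous_const
  have hn : Continuous fun u => max (-D u) 0 := hD.neg.max continuous_const
  have hsub : (∫ u in (-π)..π, max (D u) 0) - ∫ u in (-π)..π, max (-D u) 0 = 0 := by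
    rw [← intervalIntegral.integral_sub (hp.intervalIntegrable _ _) (hn.intervalIntegrable _ _)]
    refine Eq.trans (intervalIntegral.integral_congr fun u _ => ?_) (integral_doubleCosSum_eq_zero hT m)
    simp only [hDdef, max_zero_sub_max_neg_zero_eq_self]
  have hadd : (∫ u in (-π)..π, max (D u) 0) + ∫ u in (-π)..π, max (-D u) 0 = ∫ u in (-π)..π, |D u| := by
    rw [← intervalIntegral.integral_add (hp.intervalIntegrable _ _) (hn.intervalIntegrable _ _)]
    refine intervalIntegral.integral_congr fun u _ => ?_
    rcases le_total 0 (D u) with h | h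
    · rw [max_eq_left h, max_eq_right (by linarith), abs_of_nonneg h, add_zero]
    · rw [max_eq_right h, max_eq_left (by linarith), abs_of_nonpos h, zero_add]
  constructor
  · linarith
  · linarith

/-- **`Z > 0`**: the positive part of `D_{t+1,t}` has positive mass (else `Λ ≡ 0`, but `Λ(|x|) ≤ −(t+2)∕(9t+6)`). [folklore] -/
theorem integral_posPart_pos {t : ℕ} (ht : 1 ≤ t) :
    0 < ∫ u in (-π)..π, max (∑ j ∈ range (t + 1), ∑ j' ∈ range (t + 1),
      Real.cos ((((t + 1) + t + j - j' : ℕ) : ℝ) * u)) 0 := by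
  have hD : Continuous fun u : ℝ => ∑ j ∈ range (t + 1), ∑ j' ∈ range (t + 1),
      Real.cos ((((t + 1) + t + j - j' : ℕ) : ℝ) * u) := by fun_prop
  obtain ⟨-, hhalf⟩ := integral_posPart_eq (T := t + 1) (by omega) t
  by_contra hZ
  push Not at hZ
  have habs0 : ∫ u in (-π)..π, |∑ j ∈ range (t + 1), ∑ j' ∈ range (t + 1),
      Real.cos ((((t + 1) + t + j - j' : ℕ) : ℝ) * u)| ≤ 0 := by linarith
  -- then `Λ(|x|) = ½∫_{−π}^{π} |sin u| D(u) du` vanishes, contradicting §1 with `n₀ = 0`, `a = 1`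
  have hval := functional_oddPowerSum_le (n₀ := 0) ht (by omega) zero_le_one
  simp only [Finset.sum_range_one, pow_zero, Nat.mul_zero, zero_add, pow_one, Nat.factorial_one, Nat.cast_one,
    div_one, one_mul, abs_neg] at hval
  have hsymm := integral_comp_sin_symm (g := fun x : ℝ => |x|) continuous_abs hD (doubleCosSum_even (t + 1) t)
  have hbound : |∫ u in (-π)..π, |Real.sin u| * ∑ j ∈ range (t + 1), ∑ j' ∈ range (t + 1),
      Real.cos ((((t + 1) + t + j - j' : ℕ) : ℝ) * u)| ≤ ∫ u in (-π)..π, |∑ j ∈ range (t + 1), ∑ j' ∈ range (t + 1),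
      Real.cos ((((t + 1) + t + j - j' : ℕ) : ℝ) * u)| := by
    rw [← Real.norm_eq_abs]
    refine intervalIntegral.norm_integral_le_of_norm_le (by linarith [Real.pi_pos])
      (Filter.Eventually.of_forall fun u _ => ?_) (hD.abs.intervalIntegrable _ _)
    rw [Real.norm_eq_abs, abs_mul, abs_abs]
    exact mul_le_of_le_one_left (abs_nonneg _) (Real.abs_sin_le_one u)
  have hΛ : ∫ u in (0 : ℝ)..π, (|Real.sin u| + |Real.sin u|) / 2 * ∑ j ∈ range (t + 1), ∑ j' ∈ range (t + 1),
      Real.cos ((((t + 1) + t + j - j' : ℕ) : ℝ) * u) =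
      (1 / 2) * ∫ u in (-π)..π, |Real.sin u| * ∑ j ∈ range (t + 1), ∑ j' ∈ range (t + 1),
      Real.cos ((((t + 1) + t + j - j' : ℕ) : ℝ) * u) := by
    rw [hsymm, ← intervalIntegral.integral_const_mul]
    refine intervalIntegral.integral_congr fun u _ => ?_
    simp only [abs_neg]
    ring
  have ht0 : (0 : ℝ) < t := by exact_mod_cast ht
  have hpos : (0 : ℝ) < ((t : ℝ) + 2) / (9 * t + 6) := by positivity
  rw [hΛ] at hval
  have h3 := (abs_le.1 (hbound.trans habs0)).1
  linarith

/-! ## §3 The laws `sin_*(ρ(u)du)` on `[−1,1]` [bookkeeping] -/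

/-- Integration against the push-forward by `sin` of a continuous nonnegative density `ρ` on `(−π, π]`:
`∫ g d(sin_*(ρ du)) = ∫_{−π}^{π} g(sin u)ρ(u) du` (`g` continuous). [bookkeeping] -/
theorem integral_sinLaw {ρ : ℝ → ℝ} (hρ : Continuous ρ) (hρ0 : ∀ u, 0 ≤ ρ u) {g : ℝ → ℝ} (hg : Continuous g) :
    ∫ x, g x ∂(((volume.restrict (Set.Ioc (-π) π)).withDensity fun u => ENNReal.ofReal (ρ u)).map Real.sin) =
      ∫ u in (-π)..π, g (Real.sin u) * ρ u := by
  rw [MeasureTheory.integral_map Real.measurable_sin.aemeasurable hg.aestronglyMeasurable,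
    integral_withDensity_eq_integral_toReal_smul (by fun_prop) (Filter.Eventually.of_forall fun _ => ENNReal.ofReal_lt_top),
    intervalIntegral.integral_of_le (by linarith [Real.pi_pos])]
  refine setIntegral_congr_fun measurableSet_Ioc fun u _ => ?_
  rw [ENNReal.toReal_ofReal (hρ0 u), smul_eq_mul, mul_comm]

/-- Total mass of `sin_*(ρ du)`: `ENNReal.ofReal (∫_{−π}^{π} ρ)`. [bookkeeping] -/
theorem sinLaw_univ {ρ : ℝ → ℝ} (hρ : Continuous ρ) (hρ0 : ∀ u, 0 ≤ ρ u) :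
    (((volume.restrict (Set.Ioc (-π) π)).withDensity fun u => ENNReal.ofReal (ρ u)).map Real.sin) Set.univ =
      ENNReal.ofReal (∫ u in (-π)..π, ρ u) := by
  rw [Measure.map_apply Real.measurable_sin MeasurableSet.univ, Set.preimage_univ, withDensity_apply _ MeasurableSet.univ,
    Measure.restrict_univ, intervalIntegral.integral_of_le (by linarith [Real.pi_pos]),
    ofReal_integral_eq_lintegral_ofReal]
  · exact (hρ.integrableOn_Icc).mono_set Set.Ioc_subset_Icc_self
  · exact Filter.Eventually.of_forall fun u => hρ0 u

/-- `sin_*(ρ du)` is carried by `[−1,1]`. [bookkeeping] -/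
theorem sinLaw_Icc_compl (ρ : ℝ → ℝ) :
    (((volume.restrict (Set.Ioc (-π) π)).withDensity fun u => ENNReal.ofReal (ρ u)).map Real.sin) (Set.Icc (-1 : ℝ) 1)ᶜ = 0 := by
  rw [Measure.map_apply Real.measurable_sin measurableSet_Icc.compl]
  have : Real.sin ⁻¹' (Set.Icc (-1 : ℝ) 1)ᶜ = ∅ := by
    ext u
    simp only [Set.mem_preimage, Set.mem_compl_iff, Set.mem_empty_iff_false, iff_false, not_not]
    exact Real.sin_mem_Icc u
  rw [this, measure_empty]

/-! ## §4 The witness pair on `[−1,1]` [folklore] -/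

/-- ★★★ **LAWS AGREEING ON `Π_t`, DISAGREEING ON THE KINKS.**  For every `t ≥ 1` there are probability laws `P, Q` on `[−1,1]` with
`∫x^j dP = ∫x^j dQ` for all `j ≤ t` such that for every `a ≥ 0` and every `n₀` with `2n₀+1 ≤ t` the odd-power sum
`f(x) = Σ_{k≤n₀}(−1)^k a^{2k+1}|x|^{2k+1}∕(2k+1)!` has `∫f dQ − ∫f dP ≥ 2a∕(π(9t+6))`; in particular `∫|x| dQ − ∫|x| dP ≥ 2∕(π(9t+6))`. [folklore] -/
theorem exists_laws_equalMoments_oddPowerSum {t : ℕ} (ht : 1 ≤ t) :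
    ∃ P Q : Measure ℝ, IsProbabilityMeasure P ∧ IsProbabilityMeasure Q ∧
      P (Set.Icc (-1 : ℝ) 1)ᶜ = 0 ∧ Q (Set.Icc (-1 : ℝ) 1)ᶜ = 0 ∧
      (∀ p : ℝ[X], p.natDegree ≤ t → ∫ x, p.eval x ∂P = ∫ x, p.eval x ∂Q) ∧
      (∀ (a : ℝ) (n₀ : ℕ), 0 ≤ a → 2 * n₀ + 1 ≤ t →
        2 * a / (π * (9 * t + 6)) ≤
          (∫ x, (∑ k ∈ range (n₀ + 1), (-1) ^ k * a ^ (2 * k + 1) / ((2 * k + 1).factorial : ℝ) * |x| ^ (2 * k + 1)) ∂Q) -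
          ∫ x, (∑ k ∈ range (n₀ + 1), (-1) ^ k * a ^ (2 * k + 1) / ((2 * k + 1).factorial : ℝ) * |x| ^ (2 * k + 1)) ∂P) ∧
      2 / (π * (9 * t + 6)) ≤ (∫ x, |x| ∂Q) - ∫ x, |x| ∂P := by
  -- the kernel, its parts, the mass
  set D : ℝ → ℝ := fun u => ∑ j ∈ range (t + 1), ∑ j' ∈ range (t + 1),
    Real.cos ((((t + 1) + t + j - j' : ℕ) : ℝ) * u) with hDdef
  have hD : Continuous D := by rw [hDdef]; fun_prop
  have hDeven : ∀ u, D (-u) = D u := fun u => by simp only [hDdef, doubleCosSum_even]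
  set Z : ℝ := ∫ u in (-π)..π, max (D u) 0 with hZ
  have hZpos : 0 < Z := integral_posPart_pos ht
  obtain ⟨hZeq, hZhalf⟩ := integral_posPart_eq (T := t + 1) (by omega) t
  have hZle : Z ≤ π * (t + 1) := by
    have := integral_abs_doubleCosSum_le (t + 1) t
    rw [hZ, hZhalf]
    linarith
  set ρp : ℝ → ℝ := fun u => max (D u) 0 / Z with hρp
  set ρm : ℝ → ℝ := fun u => max (-D u) 0 / Z with hρm
  have hρpc : Continuous ρp := (hD.max continuous_const).div_const _
  have hρmc : Continuous ρm := (hD.neg.max continuous_const).div_const _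
  have hρp0 : ∀ u, 0 ≤ ρp u := fun u => div_nonneg (le_max_right _ _) hZpos.le
  have hρm0 : ∀ u, 0 ≤ ρm u := fun u => div_nonneg (le_max_right _ _) hZpos.le
  set P : Measure ℝ := ((volume.restrict (Set.Ioc (-π) π)).withDensity fun u => ENNReal.ofReal (ρp u)).map Real.sin
    with hP
  set Q : Measure ℝ := ((volume.restrict (Set.Ioc (-π) π)).withDensity fun u => ENNReal.ofReal (ρm u)).map Real.sin
    with hQ
  -- masses
  have hmassP : ∫ u in (-π)..π, ρp u = 1 := by
    simp only [hρp]
    rw [intervalIntegral.integral_div, div_eq_one_iff_eq hZpos.ne']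
  have hmassQ : ∫ u in (-π)..π, ρm u = 1 := by
    simp only [hρm]
    rw [intervalIntegral.integral_div, div_eq_one_iff_eq hZpos.ne', hZ, hZeq]
  have iP : IsProbabilityMeasure P := ⟨by rw [hP, sinLaw_univ hρpc hρp0, hmassP, ENNReal.ofReal_one]⟩
  have iQ : IsProbabilityMeasure Q := ⟨by rw [hQ, sinLaw_univ hρmc hρm0, hmassQ, ENNReal.ofReal_one]⟩
  -- the key identity `∫g dQ − ∫g dP = −(1/Z)∫_{−π}^{π} g(sin u)D(u) du = −(1/Z)∫_0^π (g(sin u)+g(−sin u))D(u) du`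
  have hkey : ∀ {g : ℝ → ℝ}, Continuous g →
      (∫ x, g x ∂Q) - ∫ x, g x ∂P = -(1 / Z) * ∫ u in (0 : ℝ)..π, (g (Real.sin u) + g (-Real.sin u)) / 2 * D u * 2 := by
    intro g hg
    rw [hQ, hP, integral_sinLaw hρmc hρm0 hg, integral_sinLaw hρpc hρp0 hg,
      ← intervalIntegral.integral_sub ((by fun_prop : Continuous fun u => g (Real.sin u) * ρm u).intervalIntegrable _ _)
        ((by fun_prop : Continuous fun u => g (Real.sin u) * ρp u).intervalIntegrable _ _)]
    have hpt : ∀ u, g (Real.sin u) * ρm u - g (Real.sin u) * ρp u = -(1 / Z) * (g (Real.sin u) * D u) := by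
      intro u
      simp only [hρm, hρp]
      have := max_zero_sub_max_neg_zero_eq_self (D u)
      field_simp
      linear_combination (-(g (Real.sin u))) * this
    simp_rw [hpt]
    rw [intervalIntegral.integral_const_mul, integral_comp_sin_symm hg hD hDeven]
    congr 1
    exact intervalIntegral.integral_congr fun u _ => by ring
  refine ⟨P, Q, iP, iQ, by rw [hP]; exact sinLaw_Icc_compl _, by rw [hQ]; exact sinLaw_Icc_compl _, fun p hp => ?_,
    fun a n₀ ha hn₀ => ?_, ?_⟩
  · -- polynomials of degree ≤ t
    have h := hkey (Polynomial.continuous p)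
    rw [intervalIntegral.integral_mul_const] at h
    simp only [hDdef] at h
    rw [functional_polynomial_eq_zero (T := t + 1) t (p := p) (Nat.lt_succ_of_le hp), zero_mul, mul_zero,
      sub_eq_zero] at h
    exact h.symm
  · -- the odd-power sums
    have hfc : Continuous fun x : ℝ => ∑ k ∈ range (n₀ + 1),
        (-1) ^ k * a ^ (2 * k + 1) / ((2 * k + 1).factorial : ℝ) * |x| ^ (2 * k + 1) := by fun_prop
    have h := hkey hfc
    have hval := functional_oddPowerSum_le ht hn₀ ha
    rw [intervalIntegral.integral_mul_const] at h
    simp only [hDdef] at h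
    rw [h]
    have ht0 : (0 : ℝ) < t := by exact_mod_cast ht
    -- `−(1/Z)·Λ·2 ≥ (2/Z)·a(t+2)/(9t+6) ≥ 2a/(π(9t+6))`
    have h2 : 2 * a / (π * (9 * t + 6)) ≤ (1 / Z) * (a * (t + 2) / (9 * t + 6)) * 2 := by
      have hZinv : 1 / (π * (t + 1)) ≤ 1 / Z := one_div_le_one_div_of_le hZpos hZle
      have hnum : 0 ≤ a * (t + 2) / (9 * t + 6) := by positivity
      have step1 : 2 * a / (π * (9 * t + 6)) ≤ (1 / (π * (t + 1))) * (a * (t + 2) / (9 * t + 6)) * 2 := by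
        rw [div_le_iff₀ (by positivity)]
        have e : (1 / (π * (t + 1))) * (a * (t + 2) / (9 * t + 6)) * 2 * (π * (9 * t + 6)) =
            2 * a * ((t + 2) / (t + 1)) := by
          field_simp
        rw [e]
        have h1 : (1 : ℝ) ≤ (t + 2) / (t + 1) := by
          rw [le_div_iff₀ (by positivity)]
          linarith
        nlinarith
      have step2 := mul_le_mul_of_nonneg_right hZinv hnum
      linarith
    have hZi : 0 ≤ 1 / Z := by positivity
    nlinarith [mul_le_mul_of_nonneg_left hval hZi, h2]
  · -- `|x|`: the case `n₀ = 0`, `a = 1`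
    have h := hkey continuous_abs
    have hval := functional_oddPowerSum_le (n₀ := 0) ht (by omega) zero_le_one
    simp only [Finset.sum_range_one, pow_zero, Nat.mul_zero, zero_add, pow_one, Nat.factorial_one, Nat.cast_one,
      div_one, one_mul] at hval
    rw [intervalIntegral.integral_mul_const] at h
    simp only [hDdef] at h
    rw [h]
    have ht0 : (0 : ℝ) < t := by exact_mod_cast ht
    have h2 : 2 / (π * (9 * t + 6)) ≤ (1 / Z) * (((t : ℝ) + 2) / (9 * t + 6)) * 2 := by
      have hZinv : 1 / (π * (t + 1)) ≤ 1 / Z := one_div_le_one_div_of_le hZpos hZle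
      have hnum : (0 : ℝ) ≤ ((t : ℝ) + 2) / (9 * t + 6) := by positivity
      have step1 : 2 / (π * (9 * t + 6)) ≤ (1 / (π * (t + 1))) * (((t : ℝ) + 2) / (9 * t + 6)) * 2 := by
        rw [div_le_iff₀ (by positivity)]
        have e : (1 / (π * (t + 1))) * (((t : ℝ) + 2) / (9 * t + 6)) * 2 * (π * (9 * t + 6)) =
            2 * (((t : ℝ) + 2) / (t + 1)) := by
          field_simp
        rw [e]
        have h1 : (1 : ℝ) ≤ (t + 2) / (t + 1) := by
          rw [le_div_iff₀ (by positivity)]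
          linarith
        nlinarith
      have step2 := mul_le_mul_of_nonneg_right hZinv hnum
      linarith
    have hZi : 0 ≤ 1 / Z := by positivity
    nlinarith [mul_le_mul_of_nonneg_left hval hZi, h2]

end Summit.QuantumFields.YangMills.Theorems.BalabanUVNodesN19KinkLowerBoundLaws

end
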